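import Summits.HodgeConjecture.CorCM.HalfSubsetsOverImaginaryQuadratic
import HarnessLib

/-!
# Dihedral `Gal(K/k) ≅ D_p`, `p ≥ 5`: simple DEGENERATE CM abelian varieties of dimension `2p` (Weil type over `k`)

COR-CM (cell `pub-hodgecm2`), binder seat b04 (gen 19), count-neutral claim GALOIS-TWICE-ODD, part VII (the dihedral
instance of part VI, `HalfSubsetsOverImaginaryQuadratic`).  KERNEL ONLY: theorems; no definition, no named fact, no
`sorry`.  `HC_CM` is neither used nor claimed.

Gen 14 (`GaloisDodecic`): for a Galois CM field of degree `12` with Galois group `ℤ/2 × S₃ = ℤ/2 × D₃` every simple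
CM abelian sixfold is nondegenerate.  This file shows that `p = 3` is the ONLY good dihedral case:

* §1 **`exists_halfSubset_dihedral`** (group theory): in a group `H` of order `2p`, `p ≥ 5` prime, generated
  dihedrally (`r` of order `p`, an involution `s ∉ ⟨r⟩` with `s r s⁻¹ = r⁻¹`), the `p`-element set
  `N = {1, r, …, r^{p−3}} ∪ {s, s r²}` has trivial generalised stabiliser: `uN ≠ N` for `u ≠ 1` and `uN ∩ N ≠ ∅`
  for all `u ∈ H` (rotations move the arc `{r^j : j ≤ p−3}` off itself but never onto the two missing points and the
  two reflections simultaneously; a reflection `s rᵃ` sends `s, s r²` to `r^{−a}, r^{2−a}`, one of which lies on the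
  arc, and sends `1, r` to `s rᵃ, s r^{a+1}`, not both in `{s, s r²}`).
* §2 **`exists_simple_degenerate_of_dihedral`**: `K/ℚ` Galois CM, `k ⊆ K` an imaginary quadratic subfield with
  `[K : k] = 2p`, `p ≥ 5` prime, and `Gal(K/k)` dihedral ⟹ a PRIMITIVE DEGENERATE CM type and a SIMPLE CM abelian
  variety of dimension `2p` with CM by `K` carrying an exceptional Hodge class in codimension `p` on itself (a Weil
  class of `k`: the type is balanced `(p,p)` over `k`).  Seat census: for `p = 5` exactly `200` of the `720` primitive
  CM sets of `ℤ/2 × D₅` are degenerate.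

## References

* [Dodson1984] B. Dodson, *The structure of Galois groups of CM-fields*, Trans. AMS 283 (1984), §3.1.1, §3.3.1 (C),
  §4.1 (the dihedral groups `D_{2n}`, `n` odd).
* [Gordon1999HodgeAVSurvey] B. B. Gordon, *A survey of the Hodge conjecture for abelian varieties*, 9.2.2, §9.4.3.
* [Shimura1998] G. Shimura, *Abelian Varieties with Complex Multiplication and Modular Functions*, §6.2 Thm. 3, §8.2 Prop. 26.
-/

noncomputable section

open CategoryTheory CategoryTheory.Limits NumberField
open scoped BigOperators

namespace Summit.HodgeConjecture.CorCM.TwiceOdd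

open Literature.NumberTheory.ComplexMultiplication
open Literature.AlgebraicGeometry.Motives (AbelianVariety CMType)
open Literature.AlgebraicGeometry.HodgeTheory
open Literature.AlgebraicGeometry.ComplexMultiplication (IsCMTypeRealisation isSimple_iff_isPrimitive)
open Literature.AlgebraicGeometry.Pohlmann1968
open Literature.Barriers.HodgeConjecture (divisorClassesSpan)
open Summit.HodgeConjecture.CorCM.GaloisOctic (complexConj_mul_comm complexConj_mul_self
  complexConj_not_mem_fixingSubgroup)

open scoped Classical

/-! ## §1 The half subset `{1, r, …, r^{p−3}, s, s r²}` of a dihedral group of order `2p`, `p ≥ 5` -/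

section Group

variable {G : Type*} [Group G] [Fintype G] {H : Subgroup G} {r s : G} {p : ℕ}

/-- In a subgroup `H` of order `2p` containing `r` of order `p` and `s ∉ ⟨r⟩`: every element of `H` is `rʲ` or
`s rʲ` with `j < p` (`⟨r⟩` and `s⟨r⟩` are disjoint of size `p` each). [folklore] -/
theorem exists_eq_pow_or_eq_mul_pow (hr : r ∈ H) (hs : s ∈ H) (hord : orderOf r = p)
    (hsR : s ∉ Subgroup.zpowers r) (hH : Nat.card H = 2 * p) {u : G} (hu : u ∈ H) :
    ∃ j < p, u = r ^ j ∨ u = s * r ^ j := by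
  set HF : Finset G := Finset.univ.filter fun x : G => x ∈ H with hHF
  have hmemH : ∀ x, x ∈ HF ↔ x ∈ H := fun x => by rw [hHF, Finset.mem_filter]; simp
  have hHFc : HF.card = 2 * p := by rw [hHF, ← hH, Nat.card_eq_fintype_card, ← Fintype.card_subtype]
  set RF : Finset G := (Finset.range p).image fun j => r ^ j with hRF
  have hinj : Set.InjOn (fun j => r ^ j) ↑(Finset.range p) := by
    intro i hi j hj hij
    rw [Finset.coe_range, Set.mem_Iio] at hi hj
    have h := pow_inj_mod.1 (hij : r ^ i = r ^ j)
    rwa [hord, Nat.mod_eq_of_lt hi, Nat.mod_eq_of_lt hj] at h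
  have hRFc : RF.card = p := by rw [hRF, Finset.card_image_of_injOn hinj, Finset.card_range]
  set sRF : Finset G := RF.image fun x => s * x with hsRF
  have hsRFc : sRF.card = p := by rw [hsRF, Finset.card_image_of_injective _ (mul_right_injective s), hRFc]
  have hdisj : Disjoint RF sRF := by
    rw [Finset.disjoint_left]
    rintro x hx hx'
    obtain ⟨i, -, rfl⟩ := Finset.mem_image.1 hx
    obtain ⟨y, hy, hxy⟩ := Finset.mem_image.1 hx'
    obtain ⟨j, -, rfl⟩ := Finset.mem_image.1 hy
    apply hsR
    have : s = r ^ i * (r ^ j)⁻¹ := by rw [← hxy, mul_inv_cancel_right]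
    rw [this]
    exact Subgroup.mul_mem _ (Subgroup.pow_mem _ (Subgroup.mem_zpowers r) i)
      (Subgroup.inv_mem _ (Subgroup.pow_mem _ (Subgroup.mem_zpowers r) j))
  have hsub : RF ∪ sRF ⊆ HF := by
    intro x hx
    rw [hmemH]
    rcases Finset.mem_union.1 hx with hx | hx
    · obtain ⟨i, -, rfl⟩ := Finset.mem_image.1 hx
      exact H.pow_mem hr i
    · obtain ⟨y, hy, rfl⟩ := Finset.mem_image.1 hx
      obtain ⟨j, -, rfl⟩ := Finset.mem_image.1 hy
      exact H.mul_mem hs (H.pow_mem hr j)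
  have heq : RF ∪ sRF = HF := Finset.eq_of_subset_of_card_le hsub (by
    rw [Finset.card_union_of_disjoint hdisj, hRFc, hsRFc, hHFc]; omega)
  have huF : u ∈ RF ∪ sRF := by rw [heq, hmemH]; exact hu
  rcases Finset.mem_union.1 huF with h | h
  · obtain ⟨j, hj, rfl⟩ := Finset.mem_image.1 h
    exact ⟨j, Finset.mem_range.1 hj, Or.inl rfl⟩
  · obtain ⟨y, hy, rfl⟩ := Finset.mem_image.1 h
    obtain ⟨j, hj, rfl⟩ := Finset.mem_image.1 hy
    exact ⟨j, Finset.mem_range.1 hj, Or.inr rfl⟩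

/-- **The half subset of the dihedral group.**  `H` of order `2p` (`p ≥ 5` prime), `r ∈ H` of order `p`, `s ∈ H ∖ ⟨r⟩`
an involution with `s r s⁻¹ = r⁻¹`.  Then some `N ⊆ H` with `2|N| = |H|` has trivial generalised stabiliser:
`uN ≠ N` for `u ∈ H ∖ {1}` and `uN ∩ N ≠ ∅` for `u ∈ H` — namely `N = {rʲ : j ≤ p − 3} ∪ {s, s r²}`.
[cite: Dodson1984, §4.1] -/
theorem exists_halfSubset_dihedral (hp : p.Prime) (h5 : 5 ≤ p) (hr : r ∈ H) (hs : s ∈ H) (hord : orderOf r = p)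
    (hsR : s ∉ Subgroup.zpowers r) (hss : s * s = 1) (hsrs : s * r * s⁻¹ = r⁻¹) (hH : Nat.card H = 2 * p) :
    ∃ N : Finset G, (∀ n ∈ N, n ∈ H) ∧ 2 * N.card = Nat.card H ∧
      (∀ u ∈ H, u ≠ 1 → ∃ n ∈ N, u * n ∉ N) ∧ (∀ u ∈ H, ∃ n ∈ N, u * n ∈ N) := by
  -- exponent arithmetic
  have hrp : r ^ p = 1 := by rw [← hord, pow_orderOf_eq_one]
  have hrinj : ∀ {i j : ℕ}, i < p → j < p → r ^ i = r ^ j → i = j := by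
    intro i j hi hj hij
    have h := pow_inj_mod.1 hij
    rwa [hord, Nat.mod_eq_of_lt hi, Nat.mod_eq_of_lt hj] at h
  have hsinv : s⁻¹ = s := inv_eq_of_mul_eq_one_right hss
  have hflip : ∀ a : ℕ, r ^ a * s = s * (r ^ a)⁻¹ := by
    intro a
    have h1 : s * r ^ a * s⁻¹ = (r ^ a)⁻¹ := by
      rw [← MulAut.conj_apply, map_pow, MulAut.conj_apply, hsrs, inv_pow]
    rw [hsinv] at h1
    calc r ^ a * s = s * (s * r ^ a * s) := by rw [← mul_assoc, ← mul_assoc, hss, one_mul]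
      _ = s * (r ^ a)⁻¹ := by rw [h1]
  have hinvpow : ∀ {a : ℕ}, a ≤ p → (r ^ a)⁻¹ = r ^ (p - a) := by
    intro a ha
    apply inv_eq_of_mul_eq_one_right
    rw [← pow_add, Nat.add_sub_cancel' ha, hrp]
  -- `s rᵃ · s rᵇ = r^{p−a} rᵇ`, `s rᵃ · rʲ = s r^{a+j}`
  have hss' : ∀ {a b : ℕ}, a ≤ p → s * r ^ a * (s * r ^ b) = r ^ (p - a + b) := by
    intro a b ha
    rw [mul_assoc, ← mul_assoc (r ^ a), hflip, ← mul_assoc, ← mul_assoc, hss, one_mul, hinvpow ha, pow_add]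
  -- rotations are not reflections
  have hne : ∀ e f : ℕ, r ^ e ≠ s * r ^ f := by
    intro e f h
    apply hsR
    have : s = r ^ e * (r ^ f)⁻¹ := by rw [h, mul_inv_cancel_right]
    rw [this]
    exact Subgroup.mul_mem _ (Subgroup.pow_mem _ (Subgroup.mem_zpowers r) e)
      (Subgroup.inv_mem _ (Subgroup.pow_mem _ (Subgroup.mem_zpowers r) f))
  -- the set
  set N : Finset G := ((Finset.range (p - 2)).image fun j => r ^ j) ∪ {s, s * r ^ 2} with hN
  have hmemN : ∀ x, x ∈ N ↔ (∃ j < p - 2, r ^ j = x) ∨ x = s ∨ x = s * r ^ 2 := fun x => by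
    rw [hN, Finset.mem_union, Finset.mem_image, Finset.mem_insert, Finset.mem_singleton]
    simp only [Finset.mem_range]
  -- membership tests
  have hpow_mem : ∀ {e : ℕ}, e < p → (r ^ e ∈ N ↔ e < p - 2) := by
    intro e he
    rw [hmemN]
    constructor
    · rintro (⟨j, hj, hje⟩ | h | h)
      · rwa [← hrinj (by omega) he hje]
      · exact (hne e 0 (by rw [pow_zero, mul_one]; exact h)).elim
      · exact (hne e 2 h).elim
    · exact fun h => Or.inl ⟨e, h, rfl⟩
  have hrefl_mem : ∀ {e : ℕ}, e < p → (s * r ^ e ∈ N ↔ e = 0 ∨ e = 2) := by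
    intro e he
    rw [hmemN]
    constructor
    · rintro (⟨j, -, hje⟩ | h | h)
      · exact (hne j e hje).elim
      · left
        exact hrinj he hp.pos (mul_left_cancel (a := s) (by rw [h, pow_zero, mul_one]))
      · right
        exact hrinj he (by omega) (mul_left_cancel h)
    · rintro (rfl | rfl)
      · exact Or.inr (Or.inl (by rw [pow_zero, mul_one]))
      · exact Or.inr (Or.inr rfl)
  -- cardinality `p`
  have hcardN : N.card = p := by
    have hinj : Set.InjOn (fun j => r ^ j) ↑(Finset.range (p - 2)) := by
      intro i hi j hj hij
      rw [Finset.coe_range, Set.mem_Iio] at hi hj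
      exact hrinj (by omega) (by omega) hij
    have hdisj : Disjoint ((Finset.range (p - 2)).image fun j => r ^ j) {s, s * r ^ 2} := by
      rw [Finset.disjoint_left]
      intro x hx hx'
      obtain ⟨j, -, rfl⟩ := Finset.mem_image.1 hx
      rw [Finset.mem_insert, Finset.mem_singleton] at hx'
      rcases hx' with h | h
      · exact hne j 0 (by rw [pow_zero, mul_one]; exact h)
      · exact hne j 2 h
    have hs2 : s ≠ s * r ^ 2 := by
      intro h
      have h2 : r ^ 2 = r ^ 0 := by
        rw [pow_zero]; exact (mul_left_cancel (a := s) (by rw [mul_one]; exact h.symm))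
      have := hrinj (by omega) hp.pos h2
      omega
    rw [hN, Finset.card_union_of_disjoint hdisj, Finset.card_image_of_injOn hinj, Finset.card_range,
      Finset.card_pair hs2]
    omega
  refine ⟨N, ?_, by rw [hcardN, hH], ?_, ?_⟩
  · -- `N ⊆ H`
    intro n hn
    rcases (hmemN n).1 hn with ⟨j, -, rfl⟩ | rfl | rfl
    · exact H.pow_mem hr j
    · exact hs
    · exact H.mul_mem hs (H.pow_mem hr 2)
  · -- (i) `uN ≠ N`
    intro u hu hu1
    obtain ⟨a, ha, hua⟩ := exists_eq_pow_or_eq_mul_pow hr hs hord hsR hH hu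
    rcases hua with rfl | rfl
    · -- rotation `rᵃ`, `a ≠ 0`
      have ha0 : a ≠ 0 := by rintro rfl; exact hu1 (pow_zero r)
      by_cases hap : a ≤ p - 2
      · refine ⟨r ^ (p - 2 - a), (hpow_mem (by omega)).2 (by omega), ?_⟩
        rw [← pow_add, hpow_mem (by omega)]
        omega
      · refine ⟨r ^ 0, (hpow_mem hp.pos).2 (by omega), ?_⟩
        rw [← pow_add, hpow_mem (by omega)]
        omega
    · -- reflection `s rᵃ`: use `n = 1` unless `a ∈ {0, 2}`, then `n = r`
      by_cases h02 : a = 0 ∨ a = 2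
      · refine ⟨r ^ 1, (hpow_mem (by omega)).2 (by omega), ?_⟩
        rw [mul_assoc, ← pow_add, hrefl_mem (by omega)]
        omega
      · refine ⟨r ^ 0, (hpow_mem hp.pos).2 (by omega), ?_⟩
        rw [mul_assoc, ← pow_add, hrefl_mem (by omega)]
        omega
  · -- (ii) `uN ∩ N ≠ ∅`
    intro u hu
    obtain ⟨a, ha, hua⟩ := exists_eq_pow_or_eq_mul_pow hr hs hord hsR hH hu
    rcases hua with rfl | rfl
    · -- rotation: `rᵃ · r^j ∈ N` for a suitable `j`
      by_cases ha3 : a ≤ p - 3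
      · exact ⟨r ^ 0, (hpow_mem hp.pos).2 (by omega), by rw [← pow_add, hpow_mem (by omega)]; omega⟩
      · -- `a ∈ {p−2, p−1}`: `rᵃ · r^{p−a} = r^p = 1`
        refine ⟨r ^ (p - a), (hpow_mem (by omega)).2 (by omega), ?_⟩
        rw [← pow_add, Nat.add_sub_cancel' ha.le, hrp, ← pow_zero r, hpow_mem hp.pos]
        omega
    · -- reflection `s rᵃ`: `s rᵃ · s = r^{p−a}`, `s rᵃ · s r² = r^{p−a+2}`
      by_cases ha12 : a = 1 ∨ a = 2
      · refine ⟨s * r ^ 2, (hrefl_mem (by omega)).2 (Or.inr rfl), ?_⟩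
        rw [hss' ha.le]
        rcases ha12 with rfl | rfl
        · rw [show p - 1 + 2 = p + 1 by omega, pow_add, hrp, one_mul, pow_one, ← pow_one r, hpow_mem (by omega)]
          omega
        · rw [show p - 2 + 2 = p by omega, hrp, ← pow_zero r, hpow_mem hp.pos]
          omega
      · refine ⟨s, (hrefl_mem hp.pos).2 (Or.inl rfl) |> fun h => by rw [pow_zero, mul_one] at h; exact h, ?_⟩
        have h1 : s * r ^ a * s = r ^ (p - a) := by
          have := hss' (b := 0) ha.le
          rwa [pow_zero, mul_one, add_zero] at this
        rw [h1]
        by_cases ha0 : a = 0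
        · subst ha0
          rw [Nat.sub_zero, hrp, ← pow_zero r, hpow_mem hp.pos]
          omega
        · rw [hpow_mem (by omega)]
          omega

end Group

/-! ## §2 Field dress: `Gal(K/k)` dihedral of order `2p`, `p ≥ 5` -/

section Field

variable {K : Type} [Field K] [NumberField K] [IsCMField K]

/-- **`Gal(K/k) ≅ D_p`, `p ≥ 5` ⟹ a PRIMITIVE DEGENERATE CM type** (`K/ℚ` Galois CM, `k ⊆ K` of degree `2` with a
complex place; `r, s ∈ Gal(K/k)`, `r` of prime order `p ≥ 5`, `s ∉ ⟨r⟩` an involution with `s r s⁻¹ = r⁻¹`,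
`[K : k] = 2p`): the half system of `{1, r, …, r^{p−3}, s, s r²}` is primitive and of Weil type `(p,p)` over `k`.
[cite: Dodson1984, §3.1.1 and §4.1] [cite: Shimura1998, §8.2 Prop. 26] [cite: Gordon1999HodgeAVSurvey, §9.4.3] -/
theorem exists_isPrimitive_not_isNondegenerate_of_dihedral [IsGalois ℚ K] (k : IntermediateField ℚ K)
    (hk : Module.finrank ℚ k = 2) (τ₀ : k →+* ℂ) (hτ₀ : ComplexEmbedding.conjugate τ₀ ≠ τ₀) {p : ℕ}
    (hp : p.Prime) (h5 : 5 ≤ p) (hKk : Module.finrank k K = 2 * p) {r s : K ≃ₐ[ℚ] K}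
    (hr : r ∈ k.fixingSubgroup) (hs : s ∈ k.fixingSubgroup) (hord : orderOf r = p)
    (hsR : s ∉ Subgroup.zpowers r) (hss : s * s = 1) (hsrs : s * r * s⁻¹ = r⁻¹) (φ₀ : K →+* ℂ) :
    ∃ Φ : CMType K, IsPrimitive (ℂ ≃+* ℂ) Φ.1 φ₀ ∧ ¬ IsNondegenerate Φ := by
  obtain ⟨hcH, hH⟩ := mem_or_complexConj_mul_mem_of_quadratic k hk τ₀ hτ₀
  have hHcard : Nat.card k.fixingSubgroup = 2 * p := by rw [IsGalois.card_fixingSubgroup_eq_finrank k, hKk]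
  obtain ⟨N, hNH, hcard, h₁, h₂⟩ := exists_halfSubset_dihedral hp h5 hr hs hord hsR hss hsrs hHcard
  exact exists_isPrimitive_not_isNondegenerate_of_halfSubset k.fixingSubgroup hcH hH N hNH hcard h₁ h₂ φ₀

/-- **Dihedral `Gal(K/k)`, `p ≥ 5`: a SIMPLE DEGENERATE CM abelian variety of dimension `2p` with CM by `K`**, carrying
a rational `(p,p)`-class outside `Dᵖ ⊗ ℂ` on itself (a Weil class of the imaginary quadratic field `k`).  For `p = 3`
(`ℤ/2 × S₃`) every simple CM sixfold is nondegenerate (gen 14, `GaloisDodecic`).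
[cite: Gordon1999HodgeAVSurvey, 9.2.2 and §9.4.3] [cite: Shimura1998, §6.2 Thm. 3 and §8.2 Prop. 26]
[cite: Dodson1984, §4.1] -/
theorem exists_simple_degenerate_of_dihedral [IsGalois ℚ K] (k : IntermediateField ℚ K)
    (hk : Module.finrank ℚ k = 2) (τ₀ : k →+* ℂ) (hτ₀ : ComplexEmbedding.conjugate τ₀ ≠ τ₀) {p : ℕ}
    (hp : p.Prime) (h5 : 5 ≤ p) (hKk : Module.finrank k K = 2 * p) {r s : K ≃ₐ[ℚ] K}
    (hr : r ∈ k.fixingSubgroup) (hs : s ∈ k.fixingSubgroup) (hord : orderOf r = p)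
    (hsR : s ∉ Subgroup.zpowers r) (hss : s * s = 1) (hsrs : s * r * s⁻¹ = r⁻¹) :
    ∃ (Φ : CMType K) (φ₀ : K →+* ℂ) (A : AbelianVariety ℂ) (ι : 𝓞 K →+* End A)
      (θ : K →+* Module.End ℂ (complexBetti A.X 1)),
      IsPrimitive (ℂ ≃+* ℂ) Φ.1 φ₀ ∧ ¬ IsNondegenerate Φ ∧ IsCMTypeRealisation Φ A ι θ ∧ A.IsSimple ∧
      A.dim = 2 * p ∧
      ∃ x : complexBetti A.X (2 * p), IsRationalClass x ∧ IsOfHodgeType (2 * p) A.X (2 * p) p p x ∧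
        x ∉ divisorClassesSpan A.X (2 * p) p := by
  obtain ⟨hcH, hH⟩ := mem_or_complexConj_mul_mem_of_quadratic k hk τ₀ hτ₀
  have hHcard : Nat.card k.fixingSubgroup = 2 * p := by rw [IsGalois.card_fixingSubgroup_eq_finrank k, hKk]
  have hK2 : Module.finrank ℚ K / 2 = 2 * p := by
    have h := Module.finrank_mul_finrank ℚ k K
    rw [hk, hKk] at h
    omega
  obtain ⟨N, hNH, hcard, h₁, h₂⟩ := exists_halfSubset_dihedral hp h5 hr hs hord hsR hss hsrs hHcard
  have hNp : N.card = p := by rw [hHcard] at hcard; omega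
  obtain ⟨Φ, φ₀, A, ι, θ, hprim, hdeg, hA, hsim, hdim, hx⟩ :=
    exists_simple_exceptional_of_halfSubset k.fixingSubgroup hcH hH N hNH hcard h₁ h₂
  rw [hNp, hK2] at hx
  rw [hK2] at hdim
  exact ⟨Φ, φ₀, A, ι, θ, hprim, hdeg, hA, hsim, hdim, hx⟩

end Field

end Summit.HodgeConjecture.CorCM.TwiceOdd

end
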